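import Summits.AtomisticToContinuum.BoseEinsteinCondensation.Theorems.CorrectorClosure.Negative.InsertionResidueLoadBearing
import Literature.MathematicalPhysics.QuantumManyBody.PeriodicBoseGasThm31

/-!
# Negative lemmas for crux `CorrectorClosure` (stmt-AtomisticToContinuum-12058), III:
diluteness is load-bearing — hard spheres jam above close packing

Supports stmt-AtomisticToContinuum-12058 (route `BECInsertionCorrector`).
`insertionResidue_false_allDensities`: the target `InsertionResidue` asserted at EVERY density
(`∀ ρ > 0` instead of `∃ ρ₀, ∀ ρ < ρ₀`) is FALSE for the admissible hard core of radius `1`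
(`hardCore`, `isRepulsiveFiniteRange_hardCore`) at `ρ = 64`: by pigeonhole on subcubes of side
`≤ 1/2` (`exists_close_pair`) every configuration of the cell `[0,L)^{3(N+1)}`, `L³ = (N+1)/64 ≥ 1`,
has two particles at distance `≤ 1`, so every periodic `(N+1)`-body state has energy `⊤`
(`periodicEnergy_hardCore_eq_top`), `E₀^{per} = ⊤`, every state is a near-minimiser, and the
boosted condensate `planeWave (N+1) L e₀` has zero insertion overlap. Any proof of the crux must
use `ρ < ρ₀(v)`.
-/

noncomputable section

open MeasureTheory Filter Metric WithLp
open scoped ENNReal NNReal ComplexConjugate BigOperators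

namespace Summit.AtomisticToContinuum.BoseEinsteinCondensation.Theorems.CorrectorClosure.Negative

open Literature.MathematicalPhysics.QuantumManyBody.BoseGas
open Summit.AtomisticToContinuum.BoseEinsteinCondensation.Theses.BECInsertionCorrector

/-- `L³ = (N+1)/ρ` for `L = sideLength ρ (N+1)`. [folklore] -/
theorem sideLength_succ_pow_three {ρ : ℝ} (hρ : 0 < ρ) (N : ℕ) :
    sideLength ρ (N + 1) ^ 3 = ((N : ℝ) + 1) / ρ := by
  unfold sideLength
  rw [← Real.rpow_natCast, ← Real.rpow_mul (by positivity)]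
  norm_num

/-! ## §10 Load-bearing: diluteness (`∃ ρ₀`, `ρ < ρ₀`) — hard spheres jam at high density -/

/-- The hard core of radius `1`: `v(r) = ⊤` for `r ≤ 1`, `0` beyond (an ADMISSIBLE potential). [folklore] -/
def hardCore : ℝ → ℝ≥0∞ := fun r => if r ≤ 1 then ⊤ else 0

/-- The hard core is repulsive, measurable and of finite range. [folklore] -/
theorem isRepulsiveFiniteRange_hardCore : IsRepulsiveFiniteRange hardCore :=
  ⟨Measurable.ite measurableSet_Iic measurable_const measurable_const,
    ⟨1, fun r hr => by simp [hardCore, not_le.2 hr]⟩⟩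

/-- `InsertionResidue` asserted at EVERY density (`∀ ρ > 0` instead of `∃ ρ₀, ∀ ρ < ρ₀`; everything
else verbatim). -/
def InsertionResidueAllDensities : Prop :=
  ∀ v : ℝ → ENNReal, IsRepulsiveFiniteRange v → ∀ ρ : ℝ, 0 < ρ →
    ∃ c : ℝ, 0 < c ∧ ∀ᶠ N : ℕ in Filter.atTop, ∃ δ : ENNReal, 0 < δ ∧
      ∃ Θ : PeriodicTrialState N (sideLength ρ (N + 1)),
        periodicEnergy v Θ ≤ periodicGroundStateEnergy v N (sideLength ρ (N + 1)) + δ ∧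
        ∀ Ψ : PeriodicTrialState (N + 1) (sideLength ρ (N + 1)),
          periodicEnergy v Ψ ≤ periodicGroundStateEnergy v (N + 1) (sideLength ρ (N + 1)) + δ →
          ENNReal.ofReal c ≤ ENNReal.ofReal ((sideLength ρ (N + 1) ^ 3)⁻¹) *
            (‖∫ X in cellN N (sideLength ρ (N + 1)), conj (Θ.ψ X) *
                ∫ x in cell (sideLength ρ (N + 1)), Ψ.ψ (Matrix.vecCons x X)‖₊ : ENNReal) ^ 2

/-- Two reals in `[0, L)` with the same subcube index `⌊x m/L⌋₊` are within `L/m`. [folklore] -/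
theorem abs_sub_lt_of_floor_eq {L : ℝ} {m : ℕ} (hL : 0 < L) (hm : 0 < (m : ℝ)) {x y : ℝ}
    (hx : 0 ≤ x) (hy : 0 ≤ y) (h : ⌊x * m / L⌋₊ = ⌊y * m / L⌋₊) : |x - y| < L / m := by
  have h0x : 0 ≤ x * m / L := by positivity
  have h0y : 0 ≤ y * m / L := by positivity
  have hfx := (Nat.floor_eq_iff h0x).1 rfl
  have hfy := (Nat.floor_eq_iff h0y).1 rfl
  rw [h] at hfx
  have hdiff : |x * m / L - y * m / L| < 1 := by
    rw [abs_sub_lt_iff]; constructor <;> linarith [hfx.1, hfx.2, hfy.1, hfy.2]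
  have hmL : 0 < (m : ℝ) / L := div_pos hm hL
  have : |x - y| * ((m : ℝ) / L) < 1 := by
    rw [← abs_of_pos hmL, ← abs_mul]
    have : (x - y) * ((m : ℝ) / L) = x * m / L - y * m / L := by ring
    rw [this]; exact hdiff
  calc |x - y| = |x - y| * ((m : ℝ) / L) * (L / m) := by field_simp
    _ < 1 * (L / m) := by gcongr
    _ = L / m := one_mul _

/-- **Pigeonhole on the cell.** If `m³ < M` and `2L ≤ m` then among the `M` particles of any
configuration of the cell `[0,L)^{3M}` two distinct ones are at distance `≤ 1`. [folklore] -/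
theorem exists_close_pair {M m : ℕ} {L : ℝ} (hL : 0 < L) (hm : 2 * L ≤ m) (hcard : m ^ 3 < M)
    (X : Config M) (hX : X ∈ cellN M L) :
    ∃ i j : Fin M, i < j ∧ ‖X i - X j‖ ≤ 1 := by
  have hm0 : 0 < (m : ℝ) := by linarith
  have hidx : ∀ (i : Fin M) (k : Fin 3), ⌊(X i) k * m / L⌋₊ < m := by
    intro i k
    have hx := hX i k
    have h0 : 0 ≤ (X i) k * m / L := by have := hx.1; positivity
    have h2 : (X i) k * m / L < m := by
      rw [div_lt_iff₀ hL]
      nlinarith [hx.2, hm0]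
    exact (Nat.floor_lt h0).2 h2
  let ι : Fin M → (Fin 3 → Fin m) := fun i k => ⟨⌊(X i) k * m / L⌋₊, hidx i k⟩
  have hcardι : Fintype.card (Fin 3 → Fin m) < Fintype.card (Fin M) := by
    simpa [Fintype.card_fin, Fintype.card_fun] using hcard
  obtain ⟨i, j, hij, hιij⟩ := Fintype.exists_ne_map_eq_of_card_lt ι hcardι
  have hcoord : ∀ k : Fin 3, |(X i) k - (X j) k| < L / m := by
    intro k
    have hk : ⌊(X i) k * m / L⌋₊ = ⌊(X j) k * m / L⌋₊ := by
      have := congrArg (fun f : Fin 3 → Fin m => ((f k : Fin m) : ℕ)) hιij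
      simpa [ι] using this
    exact abs_sub_lt_of_floor_eq hL hm0 (hX i k).1 (hX j k).1 hk
  have hLm : L / m ≤ 1 / 2 := by
    rw [div_le_iff₀ hm0]; linarith
  have hnorm : ‖X i - X j‖ ≤ 1 := by
    rw [EuclideanSpace.norm_eq]
    have hsum : ∑ k, ‖(X i - X j) k‖ ^ 2 ≤ 3 / 4 := by
      have hterm : ∀ k : Fin 3, ‖(X i - X j) k‖ ^ 2 ≤ 1 / 4 := by
        intro k
        rw [PiLp.sub_apply, Real.norm_eq_abs]
        have h1 : |(X i) k - (X j) k| ≤ 1 / 2 := ((hcoord k).le.trans hLm)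
        have h0 : 0 ≤ |(X i) k - (X j) k| := abs_nonneg _
        nlinarith
      calc ∑ k, ‖(X i - X j) k‖ ^ 2 ≤ ∑ _k : Fin 3, (1 / 4 : ℝ) := Finset.sum_le_sum fun k _ => hterm k
        _ = 3 / 4 := by simp; norm_num
    calc Real.sqrt (∑ k, ‖(X i - X j) k‖ ^ 2) ≤ Real.sqrt (3 / 4) := Real.sqrt_le_sqrt hsum
      _ ≤ 1 := by
          rw [Real.sqrt_le_one]; norm_num
  rcases lt_or_gt_of_ne hij with h | h
  · exact ⟨i, j, h, hnorm⟩
  · exact ⟨j, i, h, by rwa [norm_sub_rev]⟩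

/-- Above close packing every configuration of the cell has a hard-core encounter, so the periodic
interaction of the hard core is `⊤` on the whole cell. [folklore] -/
theorem periodicInteraction_hardCore_eq_top {M m : ℕ} {L : ℝ} (hL : 0 < L) (hm : 2 * L ≤ m)
    (hcard : m ^ 3 < M) (X : Config M) (hX : X ∈ cellN M L) :
    periodicInteraction hardCore L X = ⊤ := by
  obtain ⟨i, j, hij, hd⟩ := exists_close_pair hL hm hcard X hX
  unfold periodicInteraction
  refine ENNReal.sum_eq_top.2 ⟨i, Finset.mem_univ _, ENNReal.sum_eq_top.2 ⟨j, ?_, ?_⟩⟩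
  · simpa using hij
  · refine top_le_iff.1 ((le_periodizedPotential hardCore L (X i - X j)).trans' ?_)
    simp [hardCore, hd]

/-- Hence above close packing every periodic hard-sphere state has infinite energy. [folklore] -/
theorem periodicEnergy_hardCore_eq_top {M m : ℕ} {L : ℝ} (hL : 0 < L) (hm : 2 * L ≤ m)
    (hcard : m ^ 3 < M) (Ψ : PeriodicTrialState M L) : periodicEnergy hardCore Ψ = ⊤ := by
  unfold periodicEnergy
  have hmeas : Measurable fun X : Config M => (‖Ψ.ψ X‖₊ : ℝ≥0∞) ^ 2 :=
    (Ψ.contDiff.continuous.measurable.nnnorm.coe_nnreal_ennreal.pow_const 2)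
  refine top_le_iff.1 ?_
  calc (⊤ : ℝ≥0∞) = ⊤ * ∫⁻ X in cellN M L, (‖Ψ.ψ X‖₊ : ℝ≥0∞) ^ 2 := by rw [Ψ.norm_eq, mul_one]
    _ = ∫⁻ X in cellN M L, ⊤ * (‖Ψ.ψ X‖₊ : ℝ≥0∞) ^ 2 := (lintegral_const_mul ⊤ hmeas).symm
    _ ≤ ∫⁻ X in cellN M L, periodicInteraction hardCore L X * (‖Ψ.ψ X‖₊ : ℝ≥0∞) ^ 2 :=
        setLIntegral_mono' (measurableSet_cellN M L) fun X hX => by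
          rw [periodicInteraction_hardCore_eq_top hL hm hcard X hX]
    _ ≤ _ := lintegral_mono fun X => le_add_self

/-- **Load-bearing (diluteness).** `InsertionResidue` at ALL densities is FALSE: for the hard core of
radius `1` at density `ρ = 64` (box `L³ = (N+1)/64`, subcubes of side `≤ 1/2`: `⌈2L⌉³ < 27L³ < N+1`
once `L ≥ 1`) no configuration avoids an encounter, every `(N+1)`-body energy is `⊤`, every state is
a near-minimiser, and the boosted condensate of §2 has zero insertion overlap. Any proof must use
`ρ < ρ₀(v)` (below close packing for hard cores). [folklore] -/
theorem insertionResidue_false_allDensities : ¬ InsertionResidueAllDensities := by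
  intro h
  obtain ⟨c, hc, hev⟩ := h hardCore isRepulsiveFiniteRange_hardCore 64 (by norm_num)
  obtain ⟨N, ⟨δ, _hδ, Θ, _hΘ, H⟩, hN⟩ := (hev.and (Filter.eventually_ge_atTop 63)).exists
  have hρ : (0 : ℝ) < 64 := by norm_num
  have hL := sideLength_succ_pos hρ N
  set L := sideLength 64 (N + 1) with hLdef
  have hL3 : L ^ 3 = ((N : ℝ) + 1) / 64 := sideLength_succ_pow_three hρ N
  have hL1 : 1 ≤ L := by
    have h1 : (1 : ℝ) ≤ L ^ 3 := by
      rw [hL3, le_div_iff₀ hρ]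
      have : (63 : ℝ) ≤ N := by exact_mod_cast hN
      linarith
    by_contra hlt
    push Not at hlt
    have : L ^ 3 < 1 ^ 3 := pow_lt_pow_left₀ hlt hL.le (by norm_num)
    linarith
  -- subcube count m = ⌈2L⌉
  set m : ℕ := ⌈2 * L⌉₊ with hm
  have hm2 : 2 * L ≤ m := Nat.le_ceil _
  have hmlt : (m : ℝ) < 2 * L + 1 := Nat.ceil_lt_add_one (by positivity)
  have hm3L : (m : ℝ) ≤ 3 * L := by linarith
  have hcardR : (m : ℝ) ^ 3 < (N : ℝ) + 1 := by
    have : (m : ℝ) ^ 3 ≤ (3 * L) ^ 3 := pow_le_pow_left₀ (by positivity) hm3L 3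
    nlinarith [hL3, this, hL1]
  have hcard : m ^ 3 < N + 1 := by exact_mod_cast hcardR
  have hE : ∀ Ψ : PeriodicTrialState (N + 1) L, periodicEnergy hardCore Ψ = ⊤ := fun Ψ =>
    periodicEnergy_hardCore_eq_top hL hm2 hcard Ψ
  have hE0 : periodicGroundStateEnergy hardCore (N + 1) L = ⊤ :=
    iInf_eq_top.2 hE
  have h := H (planeWave (N + 1) hL e0) (by rw [hE0]; exact le_top)
  rw [insertionOverlap_planeWave_succ N hL e0_ne_zero] at h
  simp only [nnnorm_zero, ENNReal.coe_zero, ne_eq, OfNat.ofNat_ne_zero, not_false_eq_true,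
    zero_pow, mul_zero, nonpos_iff_eq_zero, ENNReal.ofReal_eq_zero] at h
  linarith


end Summit.AtomisticToContinuum.BoseEinsteinCondensation.Theorems.CorrectorClosure.Negative

end
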